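import Summits.Ventures.HSemireg.WedgeHankelRecurrenceSynthesisProjective
import Summits.Ventures.HSemireg.WedgeHankelRecurrenceClasses
import Summits.Ventures.HSemireg.WedgeHankelRecurrenceCensusPolar
import Mathlib.FieldTheory.IsAlgClosed.Basic

/-!
# Venture HSemireg — THE CANONICAL FORM OF A CLASS OVER AN ALGEBRAICALLY CLOSED FIELD (generalised Sylvester ∕ confluent Prony): **every `q` on `[0, N]` of middle rank `R^N(q) = r`
# (`2r ≤ N + 1`) is `q_j = Σ_{i<n} (expMul λ_i q_i)_j + τ_j` with DISTINCT nodes `λ_i`, sequences `q_i` of EXACT orders `P_i`, a polar part `τ` of EXACT order `e`, and TOTAL LENGTH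
# `Σ_i (P_i + 1) + e = r`** — the nodes are the distinct roots of the minimal recurrence `m`, `P_i + 1` their multiplicities, `e = r − deg m`; the data `(q_i, τ|_{[0,N]})` is unique

HONEST FRAMING. Part of the Lean index of the computation cell `pub-hsemireg` (seat p10 gen 30, Sunday typer «UNIFORM-IN-n»).
LINEAR ALGEBRA OF HANKEL (catalecticant) MATRICES and of polynomials over a field ONLY: no variety, no cohomology theory, no sheaf, no Ext group and no semiregularity map is constructed
here; nothing here says that HC / HC_CM / HC_AV holds; no Literature fact is declared or used.  Custodian versions as in `WedgeHankelSiegelIdeal` (1/3); the dictionary (`Σ_i expMul λ_i q_i`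
= a divisor class `Σ_i exp(λ_i Θ) v_i` on the affine rational normal curve, the tail `τ` = a polar part of order `e` at `∞`; «over `k = k̄` the apolar scheme of a binary form of border rank
`r ≤ (N+1)/2` is a length-`r` subscheme `Σ (P_i + 1)[λ_i] + e[∞]` of `P¹` and the form is the corresponding generalised sum of powers» — Sylvester 1851, Iarrobino–Kanev LNM 1721 Thm. 1.43,
confluent Prony) is QUOTED in docstrings, never asserted.

WHAT IS IN THE TREE.  N36 (`WedgeHankelRecurrenceSynthesisProjective`, № 265): **`rank_half_eq_and_divisorPoly_mem_recSpace_iff`** (`e ≥ 1`) and **`…_iff_of_affine`** (`e = 0`): for GIVEN distinct nodes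
`λ_i`, orders `P_i` and `e`, `R^N(q) = D + e ∧ ∏ (X − λ_i)^{P_i+1} ∈ Rec_{D+e}(q)` iff `q` is the generalised sum above (`D = Σ (P_i + 1)`, `2(D + e) ≤ N + 1`), and `divisor_polar_unique`;
N20 (№ 181) `divisorPoly_ne_zero`, `natDegree_divisorPoly`; N43 (№ 323) `IsAffineClass`, `exists_smul_eq_of_mem_recSpace_self`, `natDegree_eq_of_mem_recSpace_self`; N51 (№ 340)
`eq_of_eq_smul_of_monic`; N18 (№ 173) `exists_recSpace_self_eq_span`, `natDegree_le_of_mem_recSpace`.  Mathlib: `IsAlgClosed.splits` / `Polynomial.Splits.eq_prod_roots`,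
`IsAlgClosed.card_roots_eq_natDegree`, `Finset.prod_multiset_map_count` (group the root multiset by distinct roots), `Multiset.toFinset_sum_count_eq`, `Multiset.one_le_count_iff_mem`,
`Finset.equivFin`, `Fintype.prod_equiv` / `Fintype.sum_equiv`.
THIS FILE (namespace `Summit.Ventures.HSemireg.Wedge.HankelOuter` continued; PLAIN on N36 + N43 + N51 (+ `Mathlib.FieldTheory.IsAlgClosed.Basic`); 0 definitions):
* §611 `exists_eq_C_mul_prod_X_sub_C_pow` (ALGEBRAICALLY CLOSED: every `p` is `lc(p)·∏_{i<n} (X − λ_i)^{P_i+1}` with distinct `λ_i` and `Σ (P_i + 1) = deg p`), `mem_of_eq_C_leadingCoeff_mul`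
  (`p = lc(p)·w ≠ 0` in a subspace ⇒ `w` in it), **`eq_of_monic_of_mem_recSpace_self`** (THE MONIC MINIMAL RECURRENCE IS UNIQUE, affine or polar: two monic members of `Rec_r(q)` coincide).
* §612 **`exists_canonicalForm`** (THE THEOREM: existence of `n, λ, P, e, q_i, τ` with all the exactness conditions, `Σ (P_i + 1) + e = r`, the divisor polynomial `∏ (X − λ_i)^{P_i+1}` a minimal
  recurrence, and `IsAffineClass ⟺ e = 0`); **`canonicalForm_unique`** (for the same node data two canonical forms have the same `q_i` and the same `τ` on `[0, N]` — N36 `divisor_polar_unique`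
  with the length bookkeeping discharged); **`prod_eq_of_canonicalForm`** (THE NODE DATA IS DETERMINED: for ANY generalised sum of exact orders and length `r = Σ (P_i + 1) + e ≤ (N+1)/2`, every
  field: `R^N(q) = r` and `∏ (X − λ_i)^{P_i+1}` is THE monic minimal recurrence — it equals any monic `m ∈ Rec_r(q)`).
READING: N23 ∕ N29 ∕ N30 ∕ N36 synthesised every SPLIT configuration and N34 gave the non-split `dualSeq` form; over `k = k̄` nothing is non-split, so the split synthesis IS the structure
theorem of every class — «cactus ∕ scheme length = border rank `r`» for binary forms, with Sylvester's `N + 2 − r`-term sums (N66) as the smoothable reading.  Nothing Ext-side.  New names only.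
-/

open Module Polynomial
open scoped Matrix Polynomial

namespace Summit.Ventures.HSemireg.Wedge.HankelOuter

open Summit.Ventures.HSemireg.Wedge Summit.Ventures.HSemireg.Wedge.Hankel Summit.Ventures.HSemireg.Wedge.HankelFrameChange

variable (K : Type*) [Field K] {N : ℕ}

/-! ## §611. Splitting into distinct roots with multiplicities; the monic minimal recurrence -/

variable {K}

/-- **over an ALGEBRAICALLY CLOSED field every polynomial is `lc(p) · ∏_{i<n} (X − λ_i)^{P_i + 1}` with DISTINCT `λ_i`** (the distinct roots of `p`, `P_i + 1` their multiplicities,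
`Σ_i (P_i + 1) = deg p`; for `p = 0` read `n = 0`). -/
theorem exists_eq_C_mul_prod_X_sub_C_pow [IsAlgClosed K] (p : K[X]) :
    ∃ (n : ℕ) (lam : Fin n → K) (P : Fin n → ℕ), Function.Injective lam ∧ (∑ i, (P i + 1)) = p.natDegree ∧
      p = C p.leadingCoeff * ∏ i, (Polynomial.X - C (lam i)) ^ (P i + 1) := by
  classical
  set s : Finset K := p.roots.toFinset with hs
  let e := s.equivFin
  have hcnt : ∀ i : Fin s.card, p.roots.count (e.symm i : K) - 1 + 1 = p.roots.count (e.symm i : K) := fun i =>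
    Nat.sub_add_cancel (Multiset.one_le_count_iff_mem.mpr (Multiset.mem_toFinset.mp (e.symm i).2))
  refine ⟨s.card, fun i => (e.symm i : K), fun i => p.roots.count (e.symm i : K) - 1, fun i j h => e.symm.injective (Subtype.ext h), ?_, ?_⟩
  · calc (∑ i : Fin s.card, (p.roots.count (e.symm i : K) - 1 + 1)) = ∑ i : Fin s.card, p.roots.count (e.symm i : K) := Finset.sum_congr rfl fun i _ => hcnt i
      _ = ∑ x ∈ s, p.roots.count x := by rw [← Finset.sum_coe_sort s]; exact Fintype.sum_equiv e.symm _ (fun x => p.roots.count (x : K)) fun i => rfl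
      _ = p.natDegree := by rw [hs, Multiset.toFinset_sum_count_eq, IsAlgClosed.card_roots_eq_natDegree]
  · calc p = C p.leadingCoeff * (p.roots.map fun x => Polynomial.X - C x).prod := (IsAlgClosed.splits p).eq_prod_roots
      _ = C p.leadingCoeff * ∏ x ∈ s, (Polynomial.X - C x) ^ p.roots.count x := by rw [Finset.prod_multiset_map_count]
      _ = C p.leadingCoeff * ∏ i : Fin s.card, (Polynomial.X - C (e.symm i : K)) ^ (p.roots.count (e.symm i : K) - 1 + 1) := by
          congr 1
          rw [← Finset.prod_coe_sort s]
          exact (Fintype.prod_equiv e.symm _ (fun x => (Polynomial.X - C (x : K)) ^ p.roots.count (x : K)) fun i => by rw [hcnt i]).symm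

/-- if `p = lc(p)·w ≠ 0` lies in a subspace `W ⊆ K[X]`, so does `w`. -/
theorem mem_of_eq_C_leadingCoeff_mul {p w : K[X]} (hp0 : p ≠ 0) (h : p = C p.leadingCoeff * w) {W : Submodule K K[X]} (hp : p ∈ W) : w ∈ W := by
  have hlc : p.leadingCoeff ≠ 0 := leadingCoeff_ne_zero.mpr hp0
  have h1 : w = C p.leadingCoeff⁻¹ * p :=
    calc w = C p.leadingCoeff⁻¹ * (C p.leadingCoeff * w) := by rw [← mul_assoc, ← C_mul, inv_mul_cancel₀ hlc, C_1, one_mul]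
      _ = C p.leadingCoeff⁻¹ * p := by rw [← h]
  rw [h1, Polynomial.C_mul']
  exact Submodule.smul_mem _ _ hp

variable (K)

/-- **THE MONIC MINIMAL RECURRENCE IS UNIQUE** (affine or polar): for `R^N(q) = r`, `2r ≤ N + 1`, two MONIC members of `Rec_r(q)` coincide (the minimal window is a line, N43). -/
theorem eq_of_monic_of_mem_recSpace_self {r : ℕ} {q : ℕ → K} (hq : (hankel1 K N (N / 2) q).rank = r) (h2 : r + r ≤ N + 1) {m m' : K[X]}
    (hm : m ∈ recSpace K N q r) (hmo : m.Monic) (hm' : m' ∈ recSpace K N q r) (hmo' : m'.Monic) : m = m' := by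
  obtain ⟨c, hc⟩ := exists_smul_eq_of_mem_recSpace_self K hq h2 hm hmo.ne_zero hm'
  exact eq_of_eq_smul_of_monic K hmo hmo' hc

/-! ## §612. The canonical form: existence, uniqueness, and the node data -/

/-- **THE CANONICAL FORM OF A CLASS OVER AN ALGEBRAICALLY CLOSED FIELD (generalised Sylvester ∕ confluent Prony): for `R^N(q) = r`, `2r ≤ N + 1` there are distinct nodes `λ_i`
(`i < n`), orders `P_i`, an order `e` at infinity, sequences `q_i` with `q_i = 0` beyond `P_i` and `q_i(P_i) ≠ 0`, and a tail `τ` with `τ = 0` on `[0, N − e]` and `τ_{N+1−e} ≠ 0`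
(if `e ≥ 1`), such that `q_j = Σ_i (expMul λ_i q_i)_j + τ_j` for all `j ≤ N` and `Σ_i (P_i + 1) + e = r`;** moreover `∏_i (X − λ_i)^{P_i+1} ∈ Rec_r(q)` (it is `lc⁻¹·m` for a minimal
recurrence `m`: the `λ_i` are the distinct roots of `m`, `P_i + 1` their multiplicities, `e = r − deg m`), and the class is AFFINE iff `e = 0`. -/
theorem exists_canonicalForm [IsAlgClosed K] {r : ℕ} {q : ℕ → K} (hq : (hankel1 K N (N / 2) q).rank = r) (h2 : r + r ≤ N + 1) :
    ∃ (n : ℕ) (lam : Fin n → K) (P : Fin n → ℕ) (e : ℕ) (qs : Fin n → ℕ → K) (τ : ℕ → K),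
      Function.Injective lam ∧ (∑ i, (P i + 1)) + e = r ∧ (∏ i, (Polynomial.X - C (lam i)) ^ (P i + 1)) ∈ recSpace K N q r ∧
      (∀ i j, P i < j → qs i j = 0) ∧ (∀ i, qs i (P i) ≠ 0) ∧ (∀ j, j + e ≤ N → τ j = 0) ∧ (1 ≤ e → τ (N + 1 - e) ≠ 0) ∧ (IsAffineClass K N r q ↔ e = 0) ∧
      ∀ j ≤ N, q j = (∑ i, expMul K (lam i) (qs i) j) + τ j := by
  obtain ⟨m, hm0, hspan⟩ := exists_recSpace_self_eq_span K hq h2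
  have hm : m ∈ recSpace K N q r := by rw [hspan]; exact Submodule.mem_span_singleton_self m
  obtain ⟨n, lam, P, hlam, hdeg, hprod⟩ := exists_eq_C_mul_prod_X_sub_C_pow m
  have hwmem : (∏ i, (Polynomial.X - C (lam i)) ^ (P i + 1)) ∈ recSpace K N q r := mem_of_eq_C_leadingCoeff_mul hm0 hprod hm
  have hw0 : (∏ i, (Polynomial.X - C (lam i)) ^ (P i + 1)) ≠ 0 := divisorPoly_ne_zero K lam P
  have hwdeg : (∏ i, (Polynomial.X - C (lam i)) ^ (P i + 1)).natDegree = ∑ i, (P i + 1) := natDegree_divisorPoly K lam P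
  have hDle : (∑ i, (P i + 1)) ≤ r := by rw [hdeg]; exact natDegree_le_of_mem_recSpace K hm
  obtain ⟨e, rfl⟩ := Nat.exists_eq_add_of_le hDle
  -- every non-zero member of the minimal window has degree `Σ (P_i + 1)`
  have hdegs : ∀ m' ∈ recSpace K N q ((∑ i, (P i + 1)) + e), m' ≠ 0 → m'.natDegree = ∑ i, (P i + 1) := fun m' hm' hm'0 => by
    rw [natDegree_eq_of_mem_recSpace_self K hq h2 hwmem hw0 hm' hm'0, hwdeg]
  have hAff : IsAffineClass K N ((∑ i, (P i + 1)) + e) q ↔ e = 0 := by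
    constructor
    · rintro ⟨-, m', hm', hm'0, hm'd⟩
      have h := hdegs m' hm' hm'0
      omega
    · rintro rfl
      exact ⟨hq, _, hwmem, hw0, by rw [hwdeg, add_zero]⟩
  rcases Nat.eq_zero_or_pos e with rfl | he
  · -- affine: no polar part
    have hq' : (hankel1 K N (N / 2) q).rank = ∑ i, (P i + 1) := by rw [hq, add_zero]
    have hwmem' : (∏ i, (Polynomial.X - C (lam i)) ^ (P i + 1)) ∈ recSpace K N q (∑ i, (P i + 1)) := by rwa [add_zero] at hwmem
    obtain ⟨qs, hqs, hqsP, hrep⟩ := (rank_half_eq_and_divisorPoly_mem_recSpace_iff_of_affine K hlam P (by omega) q).mp ⟨hq', hwmem'⟩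
    exact ⟨n, lam, P, 0, qs, 0, hlam, rfl, hwmem, hqs, hqsP, fun j _ => rfl, fun h => absurd h (by omega), hAff, fun j hj => by rw [hrep j hj, Pi.zero_apply, add_zero]⟩
  · obtain ⟨qs, τ, hqs, hqsP, hτ, hτe, hrep⟩ := (rank_half_eq_and_divisorPoly_mem_recSpace_iff K hlam P he h2 q).mp ⟨hq, hwmem⟩
    exact ⟨n, lam, P, e, qs, τ, hlam, rfl, hwmem, hqs, hqsP, hτ, fun _ => hτe, hAff, hrep⟩

/-- **UNIQUENESS OF THE CANONICAL FORM FOR GIVEN NODE DATA: two generalised sums on the same distinct nodes `λ_i`, orders `≤ P_i` and polar order `≤ e` (`Σ (P_i + 1) + e = r`, `2r ≤ N + 1`)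
that agree with `q` on `[0, N]` have the same `q_i` and the same `τ` on `[0, N]`** (N36 `divisor_polar_unique`; no exactness hypothesis is needed for uniqueness). -/
theorem canonicalForm_unique {n r : ℕ} {lam : Fin n → K} (hlam : Function.Injective lam) {P : Fin n → ℕ} {e : ℕ} (hlen : (∑ i, (P i + 1)) + e = r) (h2 : r + r ≤ N + 1)
    {q : ℕ → K} {qs qs' : Fin n → ℕ → K} {τ τ' : ℕ → K} (hqs : ∀ i j, P i < j → qs i j = 0) (hqs' : ∀ i j, P i < j → qs' i j = 0)
    (hτ : ∀ j, j + e ≤ N → τ j = 0) (hτ' : ∀ j, j + e ≤ N → τ' j = 0)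
    (h : ∀ j ≤ N, q j = (∑ i, expMul K (lam i) (qs i) j) + τ j) (h' : ∀ j ≤ N, q j = (∑ i, expMul K (lam i) (qs' i) j) + τ' j) :
    qs = qs' ∧ ∀ j ≤ N, τ j = τ' j :=
  divisor_polar_unique K hlam (by omega) (by omega) hqs hqs' hτ hτ' h h'

/-- **THE NODE DATA IS DETERMINED BY THE CLASS (every field): if `q_j = Σ_i (expMul λ_i q_i)_j + τ_j` on `[0, N]` with distinct `λ_i`, EXACT orders `P_i` and a polar part of EXACT
order `e`, of length `r = Σ (P_i + 1) + e` with `2r ≤ N + 1`, then `R^N(q) = r` and the divisor polynomial `∏_i (X − λ_i)^{P_i+1}` IS the monic minimal recurrence: it equals every monic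
`m ∈ Rec_r(q)`** — so the nodes, their orders and `e = r − deg m` can be read off `m`. -/
theorem prod_eq_of_canonicalForm {n r : ℕ} {lam : Fin n → K} (hlam : Function.Injective lam) {P : Fin n → ℕ} {e : ℕ} (hlen : (∑ i, (P i + 1)) + e = r) (h2 : r + r ≤ N + 1)
    {q : ℕ → K} {qs : Fin n → ℕ → K} {τ : ℕ → K} (hqs : ∀ i j, P i < j → qs i j = 0) (hqsP : ∀ i, qs i (P i) ≠ 0) (hτ : ∀ j, j + e ≤ N → τ j = 0) (hτe : 1 ≤ e → τ (N + 1 - e) ≠ 0)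
    (h : ∀ j ≤ N, q j = (∑ i, expMul K (lam i) (qs i) j) + τ j) :
    (hankel1 K N (N / 2) q).rank = r ∧ ∀ m ∈ recSpace K N q r, m.Monic → (∏ i, (Polynomial.X - C (lam i)) ^ (P i + 1)) = m := by
  subst hlen
  have key : (hankel1 K N (N / 2) q).rank = (∑ i, (P i + 1)) + e ∧ (∏ i, (Polynomial.X - C (lam i)) ^ (P i + 1)) ∈ recSpace K N q ((∑ i, (P i + 1)) + e) := by
    rcases Nat.eq_zero_or_pos e with rfl | he
    · have hτ0 : ∀ j ≤ N, τ j = 0 := fun j hj => hτ j (by omega)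
      have h0 := (rank_half_eq_and_divisorPoly_mem_recSpace_iff_of_affine K hlam P (by omega) q).mpr ⟨qs, hqs, hqsP, fun j hj => by rw [h j hj, hτ0 j hj, add_zero]⟩
      simpa only [add_zero] using h0
    · exact (rank_half_eq_and_divisorPoly_mem_recSpace_iff K hlam P he h2 q).mpr ⟨qs, τ, hqs, hqsP, hτ, hτe he, h⟩
  exact ⟨key.1, fun m hm hmo => eq_of_monic_of_mem_recSpace_self K key.1 h2 key.2 (Polynomial.monic_prod_of_monic _ _ fun i _ => (Polynomial.monic_X_sub_C (lam i)).pow _) hm hmo⟩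

end Summit.Ventures.HSemireg.Wedge.HankelOuter
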